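import Literature.Geometry.Kaehler.ComplexTorusTateLattices
import Literature.Geometry.Kaehler.ComplexTorusPhiHFunctorial
import HarnessLib

/-!
# Isogenies from ideals of `End(X)`: `H(I)`, kernel ideals, and their Tate lattices (Kieffer 2024 §1.4.1)

For a complex torus `X = ComplexTorus Φ` (`Φ : (ι → ℝ) ≃L[ℝ] E`) with endomorphism ring
`End(X) = endRingInt Φ ⊆ M_ι(ℤ)` (the integer matrices whose real extension commutes with the complex structure,
`mem_endRingInt_iff_mul_jMatrix`, equivalently the holomorphic `mapMatrix Φ Φ A`, `mem_endRingInt_iff_contMDiff`)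
we formalize, at torus level, §1.4.1 of Kieffer's notes *Isogeny graphs in higher dimensions* (which follows
Waterhouse's thesis [Wat69, §3]):

> "Throughout, when we say that `I` is an ideal in `End(A)`, we mean that `I` is a *left* ideal (in case `End(A)`
> is not commutative) and we assume that `I` is also a lattice in `End(A)` (i.e. it has full rank over `ℤ`). This
> is equivalent to requiring that `I` contains an isogeny."
>
> "**Definition 1.4.1.** Let `A` be an abelian variety over any field `k`, and let `I` be an ideal in `End(A)`. We
> define `H(I) = ⋂_{α ∈ I} ker(α)` as a subgroup scheme; it is a finite subgroup scheme of `A`. We denote the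
> quotient isogeny by `φ_I : A → A/H(I)`."
>
> "In general … if `I` is a principal ideal of the form `End(A)α`, then `H(I) = ker(α)` and `φ_I = α`."
>
> "Conversely, starting from an isogeny with domain `A` (i.e. a subgroup scheme `K` of `A` …), one can look at the
> ideal of `End(A)`  `I = { α ∈ End(A) : K ⊂ ker(α) }`. If `K` is of the form `H(I)`, then this construction
> doesn't necessarily recover `I` (but we always recover an ideal containing `I`.)"
>
> "**Definition 1.4.2.** We say that `I ⊂ End(A)` is a *kernel ideal* if `I = { α ∈ End(A) : H(I) ⊂ ker(α) }`.
> It's easy to see that every ideal `I` is included in some kernel ideal `J` such that `H(I) = H(J)`."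
>
> "**Lemma 1.4.3.** We have `V_ℓ(φ_I)⁻¹(T_ℓ(A/H(I))) = ⋂_{α ∈ I} V_ℓ(α)⁻¹(T_ℓ(A))`.
> *Proof.* For each `α ∈ I`, the preimage `V_ℓ(α)⁻¹(T_ℓ(A))` is the overlattice of `T_ℓ(A)` corresponding to the
> finite subgroup `ker(α)[ℓ^∞]` of `A` by Proposition 1.2.5. Since `H(I)[ℓ^∞] = ⋂_{α∈I} ker(α)[ℓ^∞]`, we see that
> the overlattice of `T_ℓ(A)` corresponding to `H(I)[ℓ^∞]` is precisely `⋂_{α∈I} V_ℓ(α)⁻¹(T_ℓ(A))`. This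
> overlattice is also `V_ℓ(φ_I)⁻¹(T_ℓ(A/H(I)))`, again by Proposition 1.2.5."
>
> "**Lemma 1.4.5.** Let `I ⊂ End(A)` be a kernel ideal. For any `α ∈ End(A)`, `Iα` is also a kernel ideal.
> *Proof.* Assume `H(Iα) ⊂ ker(λ)` for some `λ ∈ End(A)`. Then `ker(α) ⊂ H(Iα) ⊂ ker(λ)`, so there exists
> `μ ∈ End(A)` such that `λ = μα`. Because `α` is surjective, the assumption `H(Iα) ⊂ ker(μα)` is equivalent to
> `H(I) ⊂ ker(μ)`, i.e. `μ ∈ I` because `I` is a kernel ideal, so `λ ∈ Iα`." [Kieffer2024IsogenyGraphs, pp. 43–45]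

Over `ℂ` the subgroup scheme `H(I)` *is* the subgroup of points, `φ_I` is the quotient map
`quotientBy Φ (H(I)) : X → X/H(I)` of `ComplexTorusQuotientFiniteSubgroup` (available as soon as `H(I)` is finite,
which holds as soon as `I` contains an isogeny, `finite_kernelSubgroup_of_mem`), and Proposition 1.2.5 is the
torus-level `latticeOf_ker_mapMatrixHom` / `latticeOf_eq_comap_quotientBy` of `ComplexTorusTateLattices`; we write
`p` for Kieffer's `ℓ` (every prime: there is no residue characteristic).  In Lemma 1.4.5 the printed proof uses
that `α` is onto and that isogenies factor ("there exists `μ` with `λ = μα`"), i.e. that `α` is an isogeny — which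
the standing full-rank convention on the ideal `Iα` forces anyway; we carry `IsIsogeny Φ Φ α` as the hypothesis.

## Contents (namespace `Literature.Geometry.Kaehler.ComplexTorus` unless stated)

* §0 (namespace `Literature.NumberTheory.EllipticCurves.RationalTateModule`, any abelian group) `latticeOf_iInf`,
  `latticeOf_inf`: `Λ(⋂ Kᵢ) = ⋂ Λ(Kᵢ)`.
* §1 Definition 1.4.1: `kernelSubgroup Φ I = H(I) = ⨅_{α ∈ I} ker ρ(α)`; the ideal of a subgroup
  `idealOfSubgroup Φ K = {α ∈ End(X) : K ⊆ ker α}` (a left ideal); the antitone Galois connection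
  `gc_kernelSubgroup_idealOfSubgroup` (`I ≤ I(K) ↔ K ≤ H(I)`), `le_idealOfSubgroup_kernelSubgroup` ("we always
  recover an ideal containing `I`"), `kernelSubgroup_idealOfSubgroup_kernelSubgroup` (`H(I(H(I))) = H(I)`),
  `kernelSubgroup_sup`, `kernelSubgroup_bot/top`.
* §2 Definition 1.4.2: `IsKernelIdeal Φ I` (`I(H(I)) = I`), `isKernelIdeal_iff_le`, `isKernelIdeal_idealOfSubgroup`
  (every `I(K)` is a kernel ideal), `isKernelIdeal_iff_exists`, `exists_isKernelIdeal_ge_kernelSubgroup_eq` ("every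
  ideal `I` is included in some kernel ideal `J` such that `H(I) = H(J)`").
* §3 `kernelSubgroup_span_singleton` (`H(End(X)α) = ker α`), `finite_kernelSubgroup_of_mem` (`I` contains an isogeny
  ⟹ `H(I)` finite), `natCard_kernelSubgroup_dvd` (`|H(I)|` divides `deg α`).
* §4 Lemma 1.4.3: `latticeOf_kernelSubgroup` (`Λ_p(H(I)) = ⨅_{α∈I} V_p(ρ(α))⁻¹(T_pX)`) and, with `φ_I = quotientBy`,
  `comap_quotientBy_kernelSubgroup_eq_iInf` (`V_p(φ_I)⁻¹ T_p(X/H(I)) = ⨅_{α∈I} V_p(α)⁻¹ T_pX`, the printed statement);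
  `moduleFinite_latticeOf_kernelSubgroup`.
* §5 Lemma 1.4.5: `IsIsogeny.mem_endRingInt`, `isIsogeny_of_mem_endRingInt` (isogenies `X → X` = elements of
  `End(X)` with `det ≠ 0`); the factorisation `exists_mem_endRingInt_mul_eq_of_ker_le` (`ker α ⊆ ker λ ⟹ λ = μα`
  with `μ ∈ End(X)`); `idealMulRight Φ I α = Iα`, `kernelSubgroup_idealMulRight` (`H(Iα) = ρ(α)⁻¹ H(I)`),
  `ker_le_kernelSubgroup_idealMulRight`; **`IsKernelIdeal.idealMulRight`** (Lemma 1.4.5);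
  `isKernelIdeal_span_singleton`, `idealOfSubgroup_ker_eq_span_singleton` (`I(ker α) = End(X)α` for an isogeny `α`).

No named facts are introduced (every statement is a definition with a body or a proved theorem).

## References

* [Kieffer2024IsogenyGraphs] J. Kieffer, *Isogeny graphs in higher dimensions* (lecture notes, 2024), §1.4.1,
  Definitions 1.4.1–1.4.2, Lemma 1.4.3, Lemma 1.4.5, pp. 43–45 (after W. C. Waterhouse, *Abelian varieties over
  finite fields*, Ann. Sci. ÉNS (4) 2 (1969), §3).
* [Lange2023AbelianVarietiesComplex] H. Lange, *Abelian Varieties over the Complex Numbers*, Springer 2023, §1.1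
  (homomorphisms of complex tori via rational/analytic representations; isogenies).
-/

noncomputable section

open Module Function
open scoped Matrix
open Literature.NumberTheory.EllipticCurves

/-! ## §0 Generic complement: `Λ(⋂ Kᵢ) = ⋂ Λ(Kᵢ)` -/

namespace Literature.NumberTheory.EllipticCurves.RationalTateModule

variable {A : Type*} [AddCommGroup A] (p : ℕ) [Fact p.Prime]

/-- **`Λ(⋂ᵢ Kᵢ) = ⋂ᵢ Λ(Kᵢ)`** (preimages commute with intersections; used for `H(I) = ⋂_{α ∈ I} ker α`).
[cite: Kieffer2024IsogenyGraphs, §1.4.1 Lemma 1.4.3 (proof), p. 44] -/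
theorem latticeOf_iInf {κ : Sort*} (K : κ → AddSubgroup A) : latticeOf p (⨅ i, K i) = ⨅ i, latticeOf p (K i) := by
  ext v
  simp only [mem_latticeOf_iff, AddSubgroup.mem_iInf, Submodule.mem_iInf]

/-- `Λ(K ∩ K') = Λ(K) ∩ Λ(K')`. [cite: Kieffer2024IsogenyGraphs, §1.4.1 Lemma 1.4.3 (proof), p. 44] -/
theorem latticeOf_inf (K K' : AddSubgroup A) : latticeOf p (K ⊓ K') = latticeOf p K ⊓ latticeOf p K' := by
  ext v
  simp only [mem_latticeOf_iff, AddSubgroup.mem_inf, Submodule.mem_inf]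

end Literature.NumberTheory.EllipticCurves.RationalTateModule

namespace Literature.Geometry.Kaehler

namespace ComplexTorus

variable {ι : Type*} [Fintype ι] [DecidableEq ι] {E : Type*} [NormedAddCommGroup E] [NormedSpace ℂ E]
  (Φ : (ι → ℝ) ≃L[ℝ] E)

/-! ## §1 Definition 1.4.1: `H(I) = ⋂_{α ∈ I} Ker α`, and the ideal of a subgroup -/

/-- **`H(I) = ⋂_{α ∈ I} ker(α)`** for a left ideal `I` of `End(X) = endRingInt Φ` (Definition 1.4.1; at torus
level / in characteristic `0` the subgroup scheme is the subgroup). [cite: Kieffer2024IsogenyGraphs, §1.4.1 Def. 1.4.1, p. 43] -/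
def kernelSubgroup (I : Ideal (endRingInt Φ)) : AddSubgroup (ComplexTorus Φ) :=
  ⨅ α ∈ I, (mapMatrixHom Φ Φ (α : Matrix ι ι ℤ)).ker

/-- Membership in `H(I)`: killed by every `α ∈ I`. [cite: Kieffer2024IsogenyGraphs, §1.4.1 Def. 1.4.1, p. 43] -/
theorem mem_kernelSubgroup_iff {I : Ideal (endRingInt Φ)} {t : ComplexTorus Φ} :
    t ∈ kernelSubgroup Φ I ↔ ∀ α ∈ I, mapMatrix Φ Φ (α : Matrix ι ι ℤ) t = 0 := by
  simp only [kernelSubgroup, AddSubgroup.mem_iInf, mem_ker_mapMatrixHom_iff]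

/-- `H(I) ⊆ ker α` for `α ∈ I`. [cite: Kieffer2024IsogenyGraphs, §1.4.1 Def. 1.4.1, p. 43] -/
theorem kernelSubgroup_le_ker {I : Ideal (endRingInt Φ)} {α : endRingInt Φ} (hα : α ∈ I) :
    kernelSubgroup Φ I ≤ (mapMatrixHom Φ Φ (α : Matrix ι ι ℤ)).ker :=
  (iInf_le _ α).trans (iInf_le _ hα)

/-- `I ↦ H(I)` is antitone. [cite: Kieffer2024IsogenyGraphs, §1.4.1 Def. 1.4.1, p. 43] -/
theorem kernelSubgroup_antitone : Antitone (kernelSubgroup Φ) := fun _ _ h ↦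
  le_iInf₂ fun _ hα ↦ kernelSubgroup_le_ker Φ (h hα)

/-- `H(0) = X`. [cite: Kieffer2024IsogenyGraphs, §1.4.1 Def. 1.4.1, p. 43] -/
@[simp] theorem kernelSubgroup_bot : kernelSubgroup Φ (⊥ : Ideal (endRingInt Φ)) = ⊤ := by
  refine eq_top_iff.2 fun t _ ↦ (mem_kernelSubgroup_iff Φ).2 fun α hα ↦ ?_
  rw [show α = 0 from (Submodule.mem_bot _).1 hα]
  exact mapMatrix_zero_matrix Φ Φ t

/-- `H(End(X)) = 0` (`1 ∈ End(X)`). [cite: Kieffer2024IsogenyGraphs, §1.4.1 Def. 1.4.1, p. 43] -/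
@[simp] theorem kernelSubgroup_top : kernelSubgroup Φ (⊤ : Ideal (endRingInt Φ)) = ⊥ := by
  refine eq_bot_iff.2 fun t ht ↦ ?_
  have h := (mem_kernelSubgroup_iff Φ).1 ht 1 Submodule.mem_top
  rw [OneMemClass.coe_one, mapMatrix_one] at h
  exact (AddSubgroup.mem_bot).2 h

/-- **The ideal of a subgroup: `I(K) = {α ∈ End(X) : K ⊆ ker(α)}`** — a LEFT ideal of `End(X)`
(`ker α ⊆ ker (βα)`). [cite: Kieffer2024IsogenyGraphs, §1.4.1 (before Def. 1.4.2), p. 43] -/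
def idealOfSubgroup (K : AddSubgroup (ComplexTorus Φ)) : Ideal (endRingInt Φ) where
  carrier := {α | K ≤ (mapMatrixHom Φ Φ (α : Matrix ι ι ℤ)).ker}
  add_mem' {α β} hα hβ t ht := by
    have h1 : mapMatrix Φ Φ (α : Matrix ι ι ℤ) t = 0 := hα ht
    have h2 : mapMatrix Φ Φ (β : Matrix ι ι ℤ) t = 0 := hβ ht
    rw [mem_ker_mapMatrixHom_iff, Subring.coe_add, mapMatrix_add_matrix, h1, h2, add_zero]
  zero_mem' t _ := by
    rw [mem_ker_mapMatrixHom_iff, ZeroMemClass.coe_zero]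
    exact mapMatrix_zero_matrix Φ Φ t
  smul_mem' β α hα := by
    rw [smul_eq_mul]
    exact hα.trans (ker_le_ker_mul Φ Φ Φ (β : Matrix ι ι ℤ) (α : Matrix ι ι ℤ))

/-- Membership in `I(K)`. [cite: Kieffer2024IsogenyGraphs, §1.4.1 (before Def. 1.4.2), p. 43] -/
@[simp] theorem mem_idealOfSubgroup_iff {K : AddSubgroup (ComplexTorus Φ)} {α : endRingInt Φ} :
    α ∈ idealOfSubgroup Φ K ↔ K ≤ (mapMatrixHom Φ Φ (α : Matrix ι ι ℤ)).ker :=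
  Iff.rfl

/-- `K ↦ I(K)` is antitone. [cite: Kieffer2024IsogenyGraphs, §1.4.1, p. 43] -/
theorem idealOfSubgroup_antitone : Antitone (idealOfSubgroup Φ) := fun _ _ h _ hα ↦ h.trans hα

/-- **The Galois connection: `I ⊆ I(K) ⟺ K ⊆ H(I)`.** [cite: Kieffer2024IsogenyGraphs, §1.4.1, p. 43] -/
theorem le_idealOfSubgroup_iff_le_kernelSubgroup {I : Ideal (endRingInt Φ)} {K : AddSubgroup (ComplexTorus Φ)} :
    I ≤ idealOfSubgroup Φ K ↔ K ≤ kernelSubgroup Φ I :=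
  ⟨fun h ↦ le_iInf₂ fun _ hα ↦ h hα, fun h _ hα ↦ h.trans (kernelSubgroup_le_ker Φ hα)⟩

/-- As an order-theoretic Galois connection between ideals and (order-dual) subgroups.
[cite: Kieffer2024IsogenyGraphs, §1.4.1, p. 43] -/
theorem gc_kernelSubgroup_idealOfSubgroup :
    GaloisConnection (fun I : Ideal (endRingInt Φ) ↦ OrderDual.toDual (kernelSubgroup Φ I))
      (fun K : (AddSubgroup (ComplexTorus Φ))ᵒᵈ ↦ idealOfSubgroup Φ (OrderDual.ofDual K)) :=
  fun _ _ ↦ (le_idealOfSubgroup_iff_le_kernelSubgroup Φ).symm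

/-- **"we always recover an ideal containing `I`": `I ⊆ I(H(I))`.** [cite: Kieffer2024IsogenyGraphs, §1.4.1 (before Def. 1.4.2), p. 43] -/
theorem le_idealOfSubgroup_kernelSubgroup (I : Ideal (endRingInt Φ)) :
    I ≤ idealOfSubgroup Φ (kernelSubgroup Φ I) :=
  (le_idealOfSubgroup_iff_le_kernelSubgroup Φ).2 le_rfl

/-- `K ⊆ H(I(K))`. [cite: Kieffer2024IsogenyGraphs, §1.4.1, p. 43] -/
theorem le_kernelSubgroup_idealOfSubgroup (K : AddSubgroup (ComplexTorus Φ)) :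
    K ≤ kernelSubgroup Φ (idealOfSubgroup Φ K) :=
  (le_idealOfSubgroup_iff_le_kernelSubgroup Φ).1 le_rfl

/-- `H(I(H(I))) = H(I)`. [cite: Kieffer2024IsogenyGraphs, §1.4.1 (before Def. 1.4.2: "some kernel ideal `J` such that `H(I) = H(J)`"), p. 43] -/
theorem kernelSubgroup_idealOfSubgroup_kernelSubgroup (I : Ideal (endRingInt Φ)) :
    kernelSubgroup Φ (idealOfSubgroup Φ (kernelSubgroup Φ I)) = kernelSubgroup Φ I :=
  le_antisymm (kernelSubgroup_antitone Φ (le_idealOfSubgroup_kernelSubgroup Φ I))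
    (le_kernelSubgroup_idealOfSubgroup Φ _)

/-- `I(H(I(K))) = I(K)`. [cite: Kieffer2024IsogenyGraphs, §1.4.1, p. 43] -/
theorem idealOfSubgroup_kernelSubgroup_idealOfSubgroup (K : AddSubgroup (ComplexTorus Φ)) :
    idealOfSubgroup Φ (kernelSubgroup Φ (idealOfSubgroup Φ K)) = idealOfSubgroup Φ K :=
  le_antisymm (idealOfSubgroup_antitone Φ (le_kernelSubgroup_idealOfSubgroup Φ K))
    (le_idealOfSubgroup_kernelSubgroup Φ _)

/-- `H(I ⊔ J) = H(I) ∩ H(J)`. [cite: Kieffer2024IsogenyGraphs, §1.4.1 Def. 1.4.1, p. 43] -/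
theorem kernelSubgroup_sup (I J : Ideal (endRingInt Φ)) :
    kernelSubgroup Φ (I ⊔ J) = kernelSubgroup Φ I ⊓ kernelSubgroup Φ J :=
  (gc_kernelSubgroup_idealOfSubgroup Φ).l_sup

/-! ## §2 Definition 1.4.2: kernel ideals -/

/-- **Kernel ideal**: "`I ⊂ End(A)` is a *kernel ideal* if `I = {α ∈ End(A) : H(I) ⊂ ker(α)}`".
[cite: Kieffer2024IsogenyGraphs, §1.4.1 Def. 1.4.2, p. 43] -/
def IsKernelIdeal (I : Ideal (endRingInt Φ)) : Prop := idealOfSubgroup Φ (kernelSubgroup Φ I) = I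

/-- Unfolding `IsKernelIdeal`. [cite: Kieffer2024IsogenyGraphs, §1.4.1 Def. 1.4.2, p. 43] -/
theorem isKernelIdeal_iff {I : Ideal (endRingInt Φ)} :
    IsKernelIdeal Φ I ↔ idealOfSubgroup Φ (kernelSubgroup Φ I) = I :=
  Iff.rfl

/-- A kernel ideal is one with `I(H(I)) ⊆ I` (the other inclusion always holds).
[cite: Kieffer2024IsogenyGraphs, §1.4.1 Def. 1.4.2, p. 43] -/
theorem isKernelIdeal_iff_le {I : Ideal (endRingInt Φ)} :
    IsKernelIdeal Φ I ↔ idealOfSubgroup Φ (kernelSubgroup Φ I) ≤ I :=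
  ⟨fun h ↦ h.le, fun h ↦ le_antisymm h (le_idealOfSubgroup_kernelSubgroup Φ I)⟩

/-- Every ideal of a subgroup `I(K)` is a kernel ideal. [cite: Kieffer2024IsogenyGraphs, §1.4.1 Def. 1.4.2, p. 43] -/
theorem isKernelIdeal_idealOfSubgroup (K : AddSubgroup (ComplexTorus Φ)) : IsKernelIdeal Φ (idealOfSubgroup Φ K) :=
  idealOfSubgroup_kernelSubgroup_idealOfSubgroup Φ K

/-- The kernel ideals are exactly the ideals of subgroups. [cite: Kieffer2024IsogenyGraphs, §1.4.1 Def. 1.4.2, p. 43] -/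
theorem isKernelIdeal_iff_exists {I : Ideal (endRingInt Φ)} :
    IsKernelIdeal Φ I ↔ ∃ K : AddSubgroup (ComplexTorus Φ), idealOfSubgroup Φ K = I :=
  ⟨fun h ↦ ⟨_, h⟩, fun ⟨K, hK⟩ ↦ hK ▸ isKernelIdeal_idealOfSubgroup Φ K⟩

/-- **"every ideal `I` is included in some kernel ideal `J` such that `H(I) = H(J)`"** — namely `J = I(H(I))`.
[cite: Kieffer2024IsogenyGraphs, §1.4.1 (after Def. 1.4.2), p. 43] -/
theorem exists_isKernelIdeal_ge_kernelSubgroup_eq (I : Ideal (endRingInt Φ)) :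
    ∃ J : Ideal (endRingInt Φ), I ≤ J ∧ IsKernelIdeal Φ J ∧ kernelSubgroup Φ J = kernelSubgroup Φ I :=
  ⟨idealOfSubgroup Φ (kernelSubgroup Φ I), le_idealOfSubgroup_kernelSubgroup Φ I,
    isKernelIdeal_idealOfSubgroup Φ _, kernelSubgroup_idealOfSubgroup_kernelSubgroup Φ I⟩

/-- `I(H(I))` is the LEAST kernel ideal containing `I`. [cite: Kieffer2024IsogenyGraphs, §1.4.1 (after Def. 1.4.2), p. 43] -/
theorem idealOfSubgroup_kernelSubgroup_le_of_isKernelIdeal {I J : Ideal (endRingInt Φ)} (hIJ : I ≤ J)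
    (hJ : IsKernelIdeal Φ J) : idealOfSubgroup Φ (kernelSubgroup Φ I) ≤ J := by
  rw [← hJ]
  exact idealOfSubgroup_antitone Φ (kernelSubgroup_antitone Φ hIJ)

/-! ## §3 Principal ideals; finiteness of `H(I)` -/

/-- **"if `I` is a principal ideal of the form `End(A)α`, then `H(I) = ker(α)`"** (and `φ_I = α` up to the
isomorphism `X/ker α ≅ X`, p24's `IsIsogeny.exists_eq_transPeriod_quotientPeriod`).
[cite: Kieffer2024IsogenyGraphs, §1.4.1 (after Def. 1.4.1), p. 43] -/
theorem kernelSubgroup_span_singleton (α : endRingInt Φ) :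
    kernelSubgroup Φ (Ideal.span {α}) = (mapMatrixHom Φ Φ (α : Matrix ι ι ℤ)).ker := by
  refine le_antisymm (kernelSubgroup_le_ker Φ (Ideal.subset_span rfl)) (le_iInf₂ fun β hβ ↦ ?_)
  obtain ⟨γ, rfl⟩ := Ideal.mem_span_singleton'.1 hβ
  exact ker_le_ker_mul Φ Φ Φ (γ : Matrix ι ι ℤ) (α : Matrix ι ι ℤ)

/-- `I(ker α) ⊇ End(X)·α`. [cite: Kieffer2024IsogenyGraphs, §1.4.1 (after Def. 1.4.1), p. 43] -/
theorem span_singleton_le_idealOfSubgroup_ker (α : endRingInt Φ) :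
    Ideal.span {α} ≤ idealOfSubgroup Φ (mapMatrixHom Φ Φ (α : Matrix ι ι ℤ)).ker := by
  rw [← kernelSubgroup_span_singleton]
  exact le_idealOfSubgroup_kernelSubgroup Φ _

/-- **`H(I)` is finite as soon as `I` contains an isogeny** (`det α ≠ 0`: `H(I) ⊆ ker α`, a finite group —
"we assume that `I` … contains an isogeny … `H(I)` is a finite subgroup scheme").
[cite: Kieffer2024IsogenyGraphs, §1.4.1 Def. 1.4.1, p. 43] -/
theorem finite_kernelSubgroup_of_mem {I : Ideal (endRingInt Φ)} {α : endRingInt Φ} (hα : α ∈ I)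
    (hdet : (α : Matrix ι ι ℤ).det ≠ 0) : Finite (kernelSubgroup Φ I) := by
  haveI : Finite (mapMatrixHom Φ Φ (α : Matrix ι ι ℤ)).ker := (finite_ker_mapMatrixHom_iff Φ Φ _).2 hdet
  exact Finite.of_injective _ (AddSubgroup.inclusion_injective (kernelSubgroup_le_ker Φ hα))

/-- `#H(I)` divides `deg α = |det α|` for every isogeny `α ∈ I`. [cite: Kieffer2024IsogenyGraphs, §1.4.1 Def. 1.4.1, p. 43] -/
theorem natCard_kernelSubgroup_dvd {I : Ideal (endRingInt Φ)} {α : endRingInt Φ} (hα : α ∈ I) :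
    Nat.card (kernelSubgroup Φ I) ∣ (α : Matrix ι ι ℤ).det.natAbs := by
  rw [← natCard_ker_mapMatrixHom Φ Φ (α : Matrix ι ι ℤ)]
  exact AddSubgroup.card_dvd_of_le (kernelSubgroup_le_ker Φ hα)

/-! ## §4 Lemma 1.4.3: the lattice of `H(I)` -/

section Lattice

variable (p : ℕ) [Fact p.Prime]

/-- **LEMMA 1.4.3, first form: `Λ_p(H(I)) = ⋂_{α ∈ I} V_p(α)⁻¹(T_p X)`** ("Since
`H(I)[ℓ^∞] = ⋂_{α∈I} ker(α)[ℓ^∞]`, … the overlattice of `T_ℓ(A)` corresponding to `H(I)[ℓ^∞]` is precisely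
`⋂_{α∈I} V_ℓ(α)⁻¹(T_ℓ(A))`" — by Prop. 1.2.5 for each `α`, g10-#1).
[cite: Kieffer2024IsogenyGraphs, §1.4.1 Lemma 1.4.3, p. 44] -/
theorem latticeOf_kernelSubgroup (I : Ideal (endRingInt Φ)) :
    RationalTateModule.latticeOf p (kernelSubgroup Φ I) =
      ⨅ α ∈ I, (RationalTateModule.tateLattice (ComplexTorus Φ) p).comap
        (RationalTateModule.mapInt p (mapMatrixHom Φ Φ (α : Matrix ι ι ℤ))) := by
  simp only [kernelSubgroup, RationalTateModule.latticeOf_iInf, latticeOf_ker_mapMatrixHom]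

/-- **LEMMA 1.4.3: `V_p(φ_I)⁻¹(T_p(X/H(I))) = ⋂_{α ∈ I} V_p(α)⁻¹(T_p X)`** for the quotient isogeny
`φ_I : X → X/H(I)` (p24's `quotientByPeriod Φ (H I)`, `quotientMatrix`; `H(I)` finite, e.g. `I ∋` an isogeny).
[cite: Kieffer2024IsogenyGraphs, §1.4.1 Lemma 1.4.3, p. 44] -/
theorem comap_quotientBy_kernelSubgroup_eq_iInf (I : Ideal (endRingInt Φ)) [Finite (kernelSubgroup Φ I)] :
    (RationalTateModule.tateLattice (ComplexTorus (quotientByPeriod Φ (kernelSubgroup Φ I))) p).comap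
        (RationalTateModule.mapInt p (mapMatrixHom Φ (quotientByPeriod Φ (kernelSubgroup Φ I))
          (quotientMatrix Φ (kernelSubgroup Φ I)))) =
      ⨅ α ∈ I, (RationalTateModule.tateLattice (ComplexTorus Φ) p).comap
        (RationalTateModule.mapInt p (mapMatrixHom Φ Φ (α : Matrix ι ι ℤ))) := by
  rw [← latticeOf_kernelSubgroup, latticeOf_eq_comap_quotientBy]

/-- `Λ_p(H(I)) ⊆ V_p(α)⁻¹(T_p X)` for `α ∈ I`. [cite: Kieffer2024IsogenyGraphs, §1.4.1 Lemma 1.4.3, p. 44] -/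
theorem latticeOf_kernelSubgroup_le {I : Ideal (endRingInt Φ)} {α : endRingInt Φ} (hα : α ∈ I) :
    RationalTateModule.latticeOf p (kernelSubgroup Φ I) ≤
      (RationalTateModule.tateLattice (ComplexTorus Φ) p).comap
        (RationalTateModule.mapInt p (mapMatrixHom Φ Φ (α : Matrix ι ι ℤ))) := by
  rw [← latticeOf_ker_mapMatrixHom]
  exact RationalTateModule.latticeOf_mono p (kernelSubgroup_le_ker Φ hα)

/-- `Λ_p(H(I))` is a lattice (finitely generated) when `I` contains an isogeny.
[cite: Kieffer2024IsogenyGraphs, §1.4.1 Lemma 1.4.3, p. 44] -/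
theorem moduleFinite_latticeOf_kernelSubgroup {I : Ideal (endRingInt Φ)} {α : endRingInt Φ} (hα : α ∈ I)
    (hdet : (α : Matrix ι ι ℤ).det ≠ 0) :
    Module.Finite ℤ_[p] (RationalTateModule.latticeOf p (kernelSubgroup Φ I)) := by
  haveI := finite_kernelSubgroup_of_mem Φ hα hdet
  haveI : Finite ↥(kernelSubgroup Φ I ⊓ AddCommGroup.primaryComponent (ComplexTorus Φ) p) :=
    Finite.of_injective _ (AddSubgroup.inclusion_injective inf_le_left)
  rw [← RationalTateModule.latticeOf_inf_primaryComponent]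
  exact (moduleFinite_latticeOf_iff_finite Φ p inf_le_right).2 this

end Lattice

/-! ## §5 Lemma 1.4.5: `I` a kernel ideal ⟹ `Iα` a kernel ideal, for an isogeny `α` -/

/-- An isogeny `ρ(A) : X → X` is an element of `End(X)` (its analytic representation is `ℂ`-linear).
[cite: Kieffer2024IsogenyGraphs, §1.4.1, p. 43] -/
theorem IsIsogeny.mem_endRingInt {A : Matrix ι ι ℤ} (hA : IsIsogeny Φ Φ A) : A ∈ endRingInt Φ := by
  obtain ⟨f, hf⟩ := hA.1
  exact (mem_endRingInt_iff_contMDiff Φ one_ne_zero).2 (contMDiff_mapMatrix f hf)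

/-- An element of `End(X)` with `det ≠ 0` is an isogeny. [cite: Kieffer2024IsogenyGraphs, §1.4.1, p. 43] -/
theorem isIsogeny_of_mem_endRingInt {A : Matrix ι ι ℤ} (hA : A ∈ endRingInt Φ) (hdet : A.det ≠ 0) :
    IsIsogeny Φ Φ A :=
  (isIsogeny_iff_det_ne_zero Φ Φ A).2
    ⟨(contMDiff_mapMatrix_iff_exists_linear_analyticRep one_ne_zero A).1
      ((mem_endRingInt_iff_contMDiff Φ one_ne_zero).1 hA), hdet⟩

/-- **Factorisation through an isogeny inside `End(X)`** ("`ker(α) ⊂ ker(λ)`, so there exists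
`μ ∈ End(A)` such that `λ = μα`"): for an isogeny `ρ(A) : X → X` and `B ∈ End(X)` with `Ker ρ(A) ⊆ Ker ρ(B)`
there is `C ∈ End(X)` with `C A = B` (the columns of `C` are the lattice vectors `B_ℝ A_ℝ⁻¹ eⱼ`; `C`
commutes with the complex structure because `A` and `B` do).
[cite: Kieffer2024IsogenyGraphs, §1.4.1 Lemma 1.4.5 (proof), p. 45] -/
theorem exists_mem_endRingInt_mul_eq_of_ker_le {A B : Matrix ι ι ℤ} (hA : IsIsogeny Φ Φ A)
    (hB : B ∈ endRingInt Φ) (hle : (mapMatrixHom Φ Φ A).ker ≤ (mapMatrixHom Φ Φ B).ker) :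
    ∃ C ∈ endRingInt Φ, C * A = B := by
  have hbij := ((isIsogeny_iff_mulVec_bijective Φ Φ A).1 hA).2
  -- `x j = A_ℝ⁻¹ e_j`; `B_ℝ (x j)` is a lattice vector since `π(x j) ∈ Ker ρ(A) ⊆ Ker ρ(B)`
  choose x hx using fun j : ι ↦ hbij.2 (Pi.single j (1 : ℝ))
  have hcol : ∀ j : ι, ∃ n : ι → ℤ, B.map (Int.cast : ℤ → ℝ) *ᵥ x j = intVec n := fun j ↦ by
    have hmem : proj Φ (x j) ∈ (mapMatrixHom Φ Φ A).ker := by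
      rw [proj_mem_ker_mapMatrixHom_iff]
      exact ⟨Pi.single j 1, by rw [hx j, intVec_single]⟩
    exact (proj_mem_ker_mapMatrixHom_iff Φ Φ B (x j)).1 (hle hmem)
  choose n hn using hcol
  set C : Matrix ι ι ℤ := Matrix.of fun i j ↦ n j i with hC
  have hCA : C * A = B := by
    let e : (ι → ℝ) ≃ₗ[ℝ] (ι → ℝ) := LinearEquiv.ofBijective (Matrix.mulVecLin (A.map (Int.cast : ℤ → ℝ))) hbij
    have hxe : ∀ j, e.symm (Pi.single j 1) = x j := fun j ↦ by
      rw [LinearEquiv.symm_apply_eq]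
      exact (hx j).symm
    have hmul : (C * A).map (Int.cast : ℤ → ℝ) = C.map (Int.cast : ℤ → ℝ) * A.map (Int.cast : ℤ → ℝ) :=
      Matrix.map_mul (f := Int.castRingHom ℝ)
    have hlin : Matrix.mulVecLin ((C * A).map (Int.cast : ℤ → ℝ)) = Matrix.mulVecLin (B.map (Int.cast : ℤ → ℝ)) := by
      refine Basis.ext ((Pi.basisFun ℝ ι).map e.symm) fun j ↦ ?_
      rw [Basis.map_apply, Pi.basisFun_apply, hxe j, Matrix.mulVecLin_apply, Matrix.mulVecLin_apply, hn j, hmul,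
        ← Matrix.mulVec_mulVec, hx j, Matrix.mulVec_single_one]
      funext i
      simp [intVec, hC]
    apply Matrix.map_injective (Int.cast_injective (α := ℝ))
    exact Matrix.ext_iff_mulVec.2 fun v ↦ by simpa only [Matrix.mulVecLin_apply] using LinearMap.congr_fun hlin v
  refine ⟨C, ?_, hCA⟩
  -- `C_ℝ = B_ℝ A_ℝ⁻¹` commutes with `J` because `A_ℝ` and `B_ℝ` do
  have hCA' : C.map (Int.cast : ℤ → ℝ) * A.map (Int.cast : ℤ → ℝ) = B.map (Int.cast : ℤ → ℝ) := by
    rw [← hCA]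
    exact (Matrix.map_mul (f := Int.castRingHom ℝ)).symm
  rw [mem_endRingInt_iff_mul_jMatrix]
  set Aℝ := A.map (Int.cast : ℤ → ℝ)
  set Bℝ := B.map (Int.cast : ℤ → ℝ)
  set Cℝ := C.map (Int.cast : ℤ → ℝ)
  set J := jMatrix Φ
  have hu : IsUnit Aℝ.det := isUnit_det_map_intCast A ((isIsogeny_iff_det_ne_zero Φ Φ A).1 hA).2
  have hAJ : Aℝ * J = J * Aℝ := (mem_endRingInt_iff_mul_jMatrix Φ).1 (hA.mem_endRingInt Φ)
  have hBJ : Bℝ * J = J * Bℝ := (mem_endRingInt_iff_mul_jMatrix Φ).1 hB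
  have hinvJ : Aℝ⁻¹ * J = J * Aℝ⁻¹ := by
    calc Aℝ⁻¹ * J = Aℝ⁻¹ * J * (Aℝ * Aℝ⁻¹) := by rw [Matrix.mul_nonsing_inv _ hu, Matrix.mul_one]
      _ = Aℝ⁻¹ * (J * Aℝ) * Aℝ⁻¹ := by simp only [Matrix.mul_assoc]
      _ = Aℝ⁻¹ * (Aℝ * J) * Aℝ⁻¹ := by rw [hAJ]
      _ = J * Aℝ⁻¹ := by rw [← Matrix.mul_assoc, Matrix.nonsing_inv_mul _ hu, Matrix.one_mul]
  have hC' : Cℝ = Bℝ * Aℝ⁻¹ := by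
    rw [← hCA', Matrix.mul_assoc, Matrix.mul_nonsing_inv _ hu, Matrix.mul_one]
  rw [hC', Matrix.mul_assoc, hinvJ, ← Matrix.mul_assoc, hBJ, Matrix.mul_assoc]

/-- **`Iα = {βα : β ∈ I}`**, a left ideal of `End(X)` for `α ∈ End(X)`. [cite: Kieffer2024IsogenyGraphs, §1.4.1 Lemma 1.4.5, p. 45] -/
def idealMulRight (I : Ideal (endRingInt Φ)) (α : endRingInt Φ) : Ideal (endRingInt Φ) where
  carrier := {μ | ∃ β ∈ I, β * α = μ}
  add_mem' := by
    rintro _ _ ⟨β, hβ, rfl⟩ ⟨β', hβ', rfl⟩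
    exact ⟨β + β', I.add_mem hβ hβ', add_mul β β' α⟩
  zero_mem' := ⟨0, I.zero_mem, zero_mul α⟩
  smul_mem' := by
    rintro γ _ ⟨β, hβ, rfl⟩
    exact ⟨γ * β, I.mul_mem_left γ hβ, by rw [smul_eq_mul, mul_assoc]⟩

/-- Membership in `Iα`. [cite: Kieffer2024IsogenyGraphs, §1.4.1 Lemma 1.4.5, p. 45] -/
@[simp] theorem mem_idealMulRight_iff {I : Ideal (endRingInt Φ)} {α μ : endRingInt Φ} :
    μ ∈ idealMulRight Φ I α ↔ ∃ β ∈ I, β * α = μ :=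
  Iff.rfl

/-- `βα ∈ Iα` for `β ∈ I`. [cite: Kieffer2024IsogenyGraphs, §1.4.1 Lemma 1.4.5, p. 45] -/
theorem mul_mem_idealMulRight {I : Ideal (endRingInt Φ)} {β : endRingInt Φ} (hβ : β ∈ I) (α : endRingInt Φ) :
    β * α ∈ idealMulRight Φ I α :=
  ⟨β, hβ, rfl⟩

/-- **`H(Iα) = ρ(α)⁻¹(H(I))`.** [cite: Kieffer2024IsogenyGraphs, §1.4.1 Lemma 1.4.5 (proof), p. 45] -/
theorem kernelSubgroup_idealMulRight (I : Ideal (endRingInt Φ)) (α : endRingInt Φ) :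
    kernelSubgroup Φ (idealMulRight Φ I α) = (kernelSubgroup Φ I).comap (mapMatrixHom Φ Φ (α : Matrix ι ι ℤ)) := by
  ext t
  simp only [mem_kernelSubgroup_iff, AddSubgroup.mem_comap, mapMatrixHom_apply, mem_idealMulRight_iff]
  constructor
  · intro h β hβ
    have h' := h (β * α) ⟨β, hβ, rfl⟩
    rwa [Subring.coe_mul, ← mapMatrix_mapMatrix (Φ' := Φ)] at h'
  · rintro h _ ⟨β, hβ, rfl⟩
    rw [Subring.coe_mul, ← mapMatrix_mapMatrix (Φ' := Φ)]
    exact h β hβ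

/-- `ker α ⊆ H(Iα)`. [cite: Kieffer2024IsogenyGraphs, §1.4.1 Lemma 1.4.5 (proof: "`ker(α) ⊂ H(Iα)`"), p. 45] -/
theorem ker_le_kernelSubgroup_idealMulRight (I : Ideal (endRingInt Φ)) (α : endRingInt Φ) :
    (mapMatrixHom Φ Φ (α : Matrix ι ι ℤ)).ker ≤ kernelSubgroup Φ (idealMulRight Φ I α) := by
  rw [kernelSubgroup_idealMulRight]
  intro t ht
  rw [AddSubgroup.mem_comap, (AddMonoidHom.mem_ker).1 ht]
  exact AddSubgroup.zero_mem _

/-- **LEMMA 1.4.5. "Let `I ⊂ End(A)` be a kernel ideal. For any [isogeny] `α ∈ End(A)`, `Iα` is also a kernel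
ideal."** ("Assume `H(Iα) ⊂ ker(λ)` … Then `ker(α) ⊂ H(Iα) ⊂ ker(λ)`, so there exists `μ ∈ End(A)` such that
`λ = μα`. Because `α` is surjective, the assumption `H(Iα) ⊂ ker(μα)` is equivalent to `H(I) ⊂ ker(μ)`, i.e.
`μ ∈ I` because `I` is a kernel ideal, so `λ ∈ Iα`.") [cite: Kieffer2024IsogenyGraphs, §1.4.1 Lemma 1.4.5, p. 45] -/
theorem IsKernelIdeal.idealMulRight {I : Ideal (endRingInt Φ)} (hI : IsKernelIdeal Φ I) {α : endRingInt Φ}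
    (hα : IsIsogeny Φ Φ (α : Matrix ι ι ℤ)) : IsKernelIdeal Φ (idealMulRight Φ I α) := by
  rw [isKernelIdeal_iff_le]
  intro lam hlam
  rw [mem_idealOfSubgroup_iff] at hlam
  -- `ker α ⊆ H(Iα) ⊆ ker λ`, so `λ = μ α`
  obtain ⟨M, hM, hMA⟩ := exists_mem_endRingInt_mul_eq_of_ker_le Φ hα lam.2
    ((ker_le_kernelSubgroup_idealMulRight Φ I α).trans hlam)
  refine ⟨⟨M, hM⟩, ?_, Subtype.ext hMA⟩
  -- `μ ∈ I`: `I` is a kernel ideal and `H(I) ⊆ ker μ` because `α` is onto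
  rw [← hI, mem_idealOfSubgroup_iff]
  intro t ht
  obtain ⟨s, rfl⟩ := hα.2.1 t
  have hs : s ∈ kernelSubgroup Φ (ComplexTorus.idealMulRight Φ I α) := by
    rw [kernelSubgroup_idealMulRight, AddSubgroup.mem_comap]
    exact ht
  have hs' := (mem_ker_mapMatrixHom_iff Φ Φ _ _).1 (hlam hs)
  rw [mem_ker_mapMatrixHom_iff, mapMatrix_mapMatrix, hMA]
  exact hs'

/-- The principal ideal `End(X)·α` of an isogeny `α` is a kernel ideal (`= (End(X))·α` with `End(X) = I(0)`
a kernel ideal; equivalently `I(ker α) = End(X) α`). [cite: Kieffer2024IsogenyGraphs, §1.4.1 (after Def. 1.4.1) and Lemma 1.4.5, pp. 43–45] -/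
theorem isKernelIdeal_span_singleton {α : endRingInt Φ} (hα : IsIsogeny Φ Φ (α : Matrix ι ι ℤ)) :
    IsKernelIdeal Φ (Ideal.span {α}) := by
  have htop : IsKernelIdeal Φ (⊤ : Ideal (endRingInt Φ)) := (isKernelIdeal_iff_le Φ).2 le_top
  have h := htop.idealMulRight Φ hα
  have heq : idealMulRight Φ ⊤ α = Ideal.span {α} := by
    ext μ
    rw [mem_idealMulRight_iff, Ideal.mem_span_singleton']
    exact ⟨fun ⟨β, _, h⟩ ↦ ⟨β, h⟩, fun ⟨β, h⟩ ↦ ⟨β, Submodule.mem_top, h⟩⟩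
  rwa [heq] at h

/-- `I(ker α) = End(X)·α` for an isogeny `α ∈ End(X)` (every `λ` killing `ker α` factors as `μα`).
[cite: Kieffer2024IsogenyGraphs, §1.4.1 (after Def. 1.4.1), p. 43] -/
theorem idealOfSubgroup_ker_eq_span_singleton {α : endRingInt Φ} (hα : IsIsogeny Φ Φ (α : Matrix ι ι ℤ)) :
    idealOfSubgroup Φ (mapMatrixHom Φ Φ (α : Matrix ι ι ℤ)).ker = Ideal.span {α} := by
  rw [← kernelSubgroup_span_singleton]
  exact isKernelIdeal_span_singleton Φ hα

end ComplexTorus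

end Literature.Geometry.Kaehler
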